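import Literature.NumberTheory.LFunctions.SmoothedExplicitFormulaTrivialZeros
import Literature.NumberTheory.LFunctions.SmoothedExplicitFormulaKadiri
import Literature.NumberTheory.LFunctions.FordZetaZeroDetectorLimit
import Literature.NumberTheory.LFunctions.VinogradovKorobovIntermediateDetector
import Literature.NumberTheory.LFunctions.FordZetaZeroRecipSqSum
import HarnessLib

/-!
# Ford's Lemma 4.6 (= Mossinghoff–Trudgian–Yang, Lemma 4.2) for admissible smoothings

Topic `Literature/NumberTheory/LFunctions`, family RH (explicit Vinogradov–Korobov zero-free
regions). Everything in this file is PROVED; no definition, no named fact.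

Ford 2002, **Lemma 4.6** (Mossinghoff–Trudgian–Yang 2024, **Lemma 4.2**, (4.8)): for a smoothing
`f` with `|F₀(z)| ≤ D/|z|²` on `Re z ≥ 0`, `|z| ≥ η` ((4.5)), `0 < η ≤ 1/2`, `s = 1 + it`,

  `Re K(s) ≤ −Σ_{|1+it−ρ| ≤ η} Re{F(s−ρ) + f(0)((π/2η)cot(π(s−ρ)/2η) − 1/(s−ρ))}`
  `  + (f(0)/4η)[∫ log|ζ(1−η+i(t+2ηu/π))|/cosh²u du − ∫ log|ζ(1+η+i(t+2ηu/π))|/cosh²u du]`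
  `  + D(1.8 + (log t)/3 + Σ_{|1+it−ρ| > η} |1+it−ρ|^{-2})`,   and   `K(1) ≤ F(0) + 1.8 D`.

This is the hypothesis `h42` of the in-tree assemblies of MTY Lemma 4.7 and Lemma 6.1
(`zero_inequality_intermediate_of_ford`, `VinogradovKorobovIntermediateDetector.lean`; shape
`FordDetectorIneqRaw η f D t S`). We prove it for every smoothing `f` that is ADMISSIBLE for the
tree's smoothed explicit formula (`IsSmoothedEFTest f p p' p'' x₀`: continuous, `C²` profile on
`[0, x₀]`, `0` beyond) with `f(0) ≥ 0`, from:

* the exact explicit formula `K(s) = −f(0)ζ'/ζ(s) + F₀(s−1) − Σ_ρ m(ρ)F₀(s−ρ) + J(s)`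
  (`SmoothedEF.fordK_eq_explicit`, Ford's Lemma 4.5) with the remainder evaluated over the
  trivial zeros, `|J(s)| ≤ D/4` for `Re s ≥ 1` (`SmoothedEF.norm_smoothedEFRemainder_le`) — in
  place of Ford's `D(1.72 + ⅓ log(1 + Im s))` (Lemma 3.2);
* Ford's zero detector for `ζ` at `σ = 1` for every `η ∈ (0, 1/2]`
  (`FordZetaDetector.ford_zero_detector_zeta_one`, Lemma 2.2/4.1 with the good-`η` hypothesis
  removed);
* Ford's Lemma 3.1 `−ζ'/ζ(σ) < 1/(σ−1)` (`neg_logDeriv_riemannZeta_ofReal_lt`) and Lemma 3.3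
  `Σ m(ρ)/|1−ρ|² ≤ 0.0463` (`tsum_zeroOrder_div_norm_one_sub_sq_le`).

Main results:

* `FordL46.fordDetectorIneqRaw_of_admissible` — **(4.8) at `s = 1 + it`, `t ≥ 1`**, in the form
  `FordDetectorIneqRaw η f D t S` for every bound `S` of the strict far-zero sums (in fact with
  `D(5/4 + S)` in place of `D(1.8 + (log t)/3 + S)`);
* `FordL46.re_fordK_one_le` — **`K(1) ≤ F(0) + 0.3 D`** (hence `≤ F(0) + 1.8D`,
  `re_fordK_one_le'`), by `σ ↓ 1` in the explicit formula at real `s = σ ∈ (1, 3/2)`.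

The remaining step to `h42` for Ford's kernel `f(u) = λe^{λu}w(λu)` is its admissibility
(`IsSmoothedEFTest`), which is `IsSmoothedEFTest.expTwist` of `KadiriTest.lean`'s test function;
see the follow-up file.

## References

* K. Ford, *Zero-free regions for the Riemann zeta function*, Number Theory for the Millennium II
  (Urbana 2000), A K Peters 2002 = arXiv:1910.08205: Lemmas 3.1, 3.3, 4.5, 4.6 and the proof of
  Lemma 4.6 ((4.9)–(4.10)). [Ford2002Millennium]
* M. J. Mossinghoff, T. S. Trudgian, A. Yang, *Explicit zero-free regions for the Riemann
  zeta-function*, Res. Number Theory 10 (2024) = arXiv:2212.06867: Lemma 4.2, (4.8).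
  [MossinghoffTrudgianYangRNT2024]
-/

noncomputable section

open Complex Set Filter Topology MeasureTheory Real
open Literature.Analysis.Complex.FordDetector

namespace Literature.NumberTheory.LFunctions

namespace FordL46

open SmoothedEF FordZetaDetector

variable {f p p' p'' : ℝ → ℝ} {x₀ : ℝ}

/-! ### Small lemmas -/

/-- `D ≥ 0` in Ford's (4.5) (apply it at `z = 2`, `η ≤ 2`). [folklore] -/
theorem D_nonneg {η D : ℝ} (hη : η ≤ 2)
    (hD : ∀ z : ℂ, 0 ≤ z.re → η ≤ ‖z‖ → ‖fordLaplace f z - (f 0 : ℂ) / z‖ ≤ D / ‖z‖ ^ 2) :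
    0 ≤ D := by
  have h2 := hD 2 (by simp) (by simpa using hη)
  have h3 : (0 : ℝ) ≤ D / ‖(2 : ℂ)‖ ^ 2 := (norm_nonneg _).trans h2
  rw [Complex.norm_two] at h3
  linarith

/-- `K_f` is continuous (a finite sum of `c_n n^{-s}` when `f` vanishes on `[x₀, ∞)`).
[folklore] -/
theorem continuous_fordK (hf : ∀ u, x₀ ≤ u → f u = 0) : Continuous (fordK f) := by
  set N : ℕ := ⌈Real.exp x₀⌉₊ with hN
  have hN1 : 1 ≤ N := Nat.one_le_iff_ne_zero.2 (Nat.ceil_pos.2 (Real.exp_pos _)).ne'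
  have hx : x₀ ≤ Real.log (N : ℕ) := by
    have h1 : Real.exp x₀ ≤ (N : ℕ) := Nat.le_ceil _
    have := Real.log_le_log (Real.exp_pos x₀) h1
    rwa [Real.log_exp] at this
  have heq : fordK f = fun s ↦ ∑ n ∈ Finset.range N,
      ((ArithmeticFunction.vonMangoldt n : ℝ) : ℂ) * (f (Real.log n) : ℂ) * (n : ℂ) ^ (-s) :=
    funext fun s ↦ fordK_eq_sum hf hN1 hx s
  rw [heq]
  refine continuous_finsetSum _ fun n _ ↦ ?_
  rcases Nat.eq_zero_or_pos n with rfl | hn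
  · simp only [ArithmeticFunction.map_zero, Complex.ofReal_zero, zero_mul]
    exact continuous_const
  · exact continuous_const.mul (continuous_id.neg.const_cpow (Or.inl (by exact_mod_cast hn.ne')))

open Classical in
/-- Strict far-zero bounds give the bound for the tail of the zero sum over the non-trivial zeros
outside the disc `|1 + it − ρ| ≤ η`: for every finite set `T'` of such zeros,
`Σ_{T'} m(ρ)/|s − ρ|² ≤ S`. [folklore] -/
theorem sum_far_le {t η S : ℝ} (s : ℂ) (hs : s = 1 + t * I)
    (hS : ∀ T : Finset ℂ, (∀ ρ ∈ T, riemannZeta ρ = 0 ∧ 0 < ρ.re ∧ ρ.re < 1 ∧ η < ‖1 + t * I - ρ‖) →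
      ∑ ρ ∈ T, (riemannZetaZeroOrder ρ : ℝ) / ‖1 + t * I - ρ‖ ^ 2 ≤ S)
    (T' : Finset ↥(((fordNearZeros t η).subtype (· ∈ RHWave0.riemannZetaNontrivialZeros) :
      Set RHWave0.riemannZetaNontrivialZeros)ᶜ)) :
    ∑ ρ ∈ T', (riemannZetaZeroOrder ((ρ : RHWave0.riemannZetaNontrivialZeros) : ℂ) : ℝ) /
        ‖s - ((ρ : RHWave0.riemannZetaNontrivialZeros) : ℂ)‖ ^ 2 ≤ S := by
  set e : ↥(((fordNearZeros t η).subtype (· ∈ RHWave0.riemannZetaNontrivialZeros) :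
      Set RHWave0.riemannZetaNontrivialZeros)ᶜ) ↪ ℂ :=
    ⟨fun ρ ↦ ((ρ : RHWave0.riemannZetaNontrivialZeros) : ℂ), fun a b hab ↦ by
      exact Subtype.ext (Subtype.ext hab)⟩ with he
  have h := hS (T'.map e) (fun ρ hρ ↦ ?_)
  · rw [Finset.sum_map] at h
    simpa [he, hs] using h
  rw [Finset.mem_map] at hρ
  obtain ⟨ρ', _, rfl⟩ := hρ
  have hmem := ρ'.1.2
  have hζ := ZetaZeros.riemannZetaNontrivialZeros.zeta_eq_zero hmem
  refine ⟨hζ, ZetaZeros.riemannZetaNontrivialZeros.re_pos hmem,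
    ZetaZeros.riemannZetaNontrivialZeros.re_lt_one hmem, ?_⟩
  have hnot : ((ρ' : RHWave0.riemannZetaNontrivialZeros) : ℂ) ∉ fordNearZeros t η := by
    intro hm
    have h2 : (ρ' : RHWave0.riemannZetaNontrivialZeros) ∈
        (fordNearZeros t η).subtype (· ∈ RHWave0.riemannZetaNontrivialZeros) :=
      Finset.mem_subtype.2 hm
    exact (Set.mem_compl_iff _ _).1 ρ'.2 (Finset.mem_coe.2 h2)
  rw [mem_fordNearZeros] at hnot
  push Not at hnot
  simpa [he] using hnot hζ

/-! ### Ford's Lemma 4.6, first part, for admissible smoothings -/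

/-- **Ford's Lemma 4.6 = MTY Lemma 4.2, (4.8), for an admissible smoothing** (`t ≥ 1`,
`0 < η ≤ 1/2`, `f(0) ≥ 0`, Ford's (4.5) with constant `D`): `FordDetectorIneqRaw η f D t S` for
every bound `S` of the strict far-zero sums `Σ_{|1+it−ρ| > η} m(ρ)|1+it−ρ|^{-2}`. The proof is
Ford's: the explicit formula at `s = 1 + it` (Lemma 4.5, here with `|J| ≤ D/4` and
`Re F₀(it) ≤ D/t²`), the zero detector (Lemma 2.2/4.1 at `σ = 1`) multiplied by `f(0)`, and the
split of the zero sum into `|1+it−ρ| ≤ η` (combined with the cotangent terms) and `> η`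
(bounded by `D·S`); the constant obtained is `D(5/4 + S) ≤ D(1.8 + (log t)/3 + S)`.
[cite: Ford2002Millennium, Lemma 4.6] [cite: MossinghoffTrudgianYangRNT2024, Lemma 4.2, (4.8)] -/
theorem fordDetectorIneqRaw_of_admissible (h : IsSmoothedEFTest f p p' p'' x₀)
    {η D t S : ℝ} (hη : 0 < η) (hη2 : η ≤ 1 / 2) (ht : 1 ≤ t) (hf0 : 0 ≤ f 0)
    (hD : ∀ z : ℂ, 0 ≤ z.re → η ≤ ‖z‖ → ‖fordLaplace f z - (f 0 : ℂ) / z‖ ≤ D / ‖z‖ ^ 2)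
    (hS : ∀ T : Finset ℂ, (∀ ρ ∈ T, riemannZeta ρ = 0 ∧ 0 < ρ.re ∧ ρ.re < 1 ∧ η < ‖1 + t * I - ρ‖) →
      ∑ ρ ∈ T, (riemannZetaZeroOrder ρ : ℝ) / ‖1 + t * I - ρ‖ ^ 2 ≤ S) :
    FordDetectorIneqRaw η f D t S := by
  classical
  set s : ℂ := 1 + t * I with hs
  have hsre : s.re = 1 := by simp [hs]
  have hsim : s.im = t := by simp [hs]
  have ht0 : t ≠ 0 := by intro h0; rw [h0] at ht; norm_num at ht
  have hs1 : s ≠ 1 := fun h0 ↦ ht0 (by simpa [hs] using congrArg Complex.im h0)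
  have hζs : riemannZeta s ≠ 0 := riemannZeta_ne_zero_of_one_le_re (by rw [hsre])
  have hD0 : 0 ≤ D := D_nonneg (by linarith) hD
  have hD' : ∀ z : ℂ, 0 ≤ z.re → η ≤ ‖z‖ → ‖fordLaplace₀ f z‖ ≤ D / ‖z‖ ^ 2 := hD
  have hlogt : 0 ≤ Real.log t := Real.log_nonneg ht
  ------------------------------------------------------------------
  -- the explicit formula at `s`
  ------------------------------------------------------------------
  have hE := fordK_eq_explicit h (s := s) (by rw [hsre]; norm_num) (by rw [hsre]; norm_num) hs1 hζs
  ------------------------------------------------------------------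
  -- (a) the zero detector with `S₀ = {ρ ∈ near : Re ρ > 1 − η}`
  ------------------------------------------------------------------
  set S₀ : Finset ℂ := (fordNearZeros t η).filter (fun ρ ↦ 1 - η < ρ.re) with hS₀
  have hS₀mem : ∀ ρ ∈ S₀, riemannZeta ρ = 0 ∧ 1 - η < ρ.re := by
    intro ρ hρ
    rw [hS₀, Finset.mem_filter, mem_fordNearZeros] at hρ
    exact ⟨hρ.1.1, hρ.2⟩
  have hZD := ford_zero_detector_zeta_one hη hη2 ht0 S₀ hS₀mem
  simp only [Complex.ofReal_one] at hZD
  rw [← hs] at hZD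
  -- the cotangent terms of `fordNearSum` versus `fordCot`
  have hcot : ∀ ρ ∈ fordNearZeros t η,
      ((((π / (2 * η) : ℝ) : ℂ) * Complex.cot (((π / (2 * η) : ℝ) : ℂ) * (s - ρ)))).re =
        -(fordCot η (ρ - s)).re := by
    intro ρ _
    rw [show ρ - s = -(s - ρ) by ring, fordCot_neg, neg_re, neg_neg]
    rfl
  have hcot0 : ∀ ρ ∈ fordNearZeros t η, ρ ∉ S₀ → (fordCot η (ρ - s)).re = 0 := by
    intro ρ hρ hρS
    have hρ' := hρ
    rw [mem_fordNearZeros] at hρ'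
    have hnot : ¬ (1 - η < ρ.re) := by
      intro hc; exact hρS (by rw [hS₀, Finset.mem_filter]; exact ⟨hρ, hc⟩)
    have hre : |(s - ρ).re| ≤ η := (Complex.abs_re_le_norm _).trans (by rw [hs]; exact hρ'.2)
    rw [sub_re, hsre, abs_le] at hre
    have hρre : ρ.re = 1 - η := by push Not at hnot; linarith [hre.2]
    have hw : ((π / (2 * η) : ℝ) : ℂ) * (ρ - s) =
        ((-(π / 2) : ℝ) : ℂ) + ((π / (2 * η) * (ρ.im - t) : ℝ) : ℂ) * I := by
      have e : ρ - s = ((-η : ℝ) : ℂ) + ((ρ.im - t : ℝ) : ℂ) * I := by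
        apply Complex.ext
        · simp [hsre, hρre]
        · simp [hsim]
      rw [e]
      push_cast
      have hη0 : (η : ℂ) ≠ 0 := by exact_mod_cast hη.ne'
      field_simp
    rw [fordCot, hw, Complex.re_ofReal_mul, re_cot_add_mul_I, Real.cos_neg, Real.cos_pi_div_two,
      mul_zero, zero_div, mul_zero]
  ------------------------------------------------------------------
  -- (b) the zero sum: near part + far part
  ------------------------------------------------------------------
  set Zt : RHWave0.riemannZetaNontrivialZeros → ℂ := fun ρ ↦
    (riemannZetaZeroOrder (ρ : ℂ) : ℂ) * fordLaplace₀ f (s - ρ) with hZt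
  have hZn : Summable fun ρ ↦ ‖Zt ρ‖ := summable_norm_zeroTerm h (by rw [hsre]; norm_num) hζs
  have hZ : Summable Zt := hZn.of_norm
  set N : Finset RHWave0.riemannZetaNontrivialZeros :=
    (fordNearZeros t η).subtype (· ∈ RHWave0.riemannZetaNontrivialZeros) with hN
  have hsplit := hZ.sum_add_tsum_compl (s := N)
  -- near part = sum over `fordNearZeros`
  have hnearNT : ∀ ρ ∈ fordNearZeros t η, ρ ∈ RHWave0.riemannZetaNontrivialZeros := by
    intro ρ hρ
    rw [mem_fordNearZeros] at hρ
    refine ZetaZeros.riemannZetaNontrivialZeros.mem_of_re_pos hρ.1 ?_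
    have hre : |(s - ρ).re| ≤ η := (Complex.abs_re_le_norm _).trans (by rw [hs]; exact hρ.2)
    rw [sub_re, hsre, abs_le] at hre
    linarith [hre.2]
  have hnear : ∑ ρ ∈ N, Zt ρ = ∑ ρ ∈ fordNearZeros t η,
      (riemannZetaZeroOrder ρ : ℂ) * fordLaplace₀ f (s - ρ) := by
    exact Finset.sum_subtype_of_mem (s := fordNearZeros t η)
      (fun ρ : ℂ ↦ (riemannZetaZeroOrder ρ : ℂ) * fordLaplace₀ f (s - ρ)) hnearNT
  -- far part `≤ D S`
  have hnormZ : ∀ ρ : RHWave0.riemannZetaNontrivialZeros,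
      ‖Zt ρ‖ = (riemannZetaZeroOrder (ρ : ℂ) : ℝ) * ‖fordLaplace₀ f (s - ρ)‖ := by
    intro ρ
    have hm0 : (0 : ℝ) ≤ riemannZetaZeroOrder (ρ : ℂ) := by
      exact_mod_cast riemannZetaZeroOrder_nonneg (ZetaZeros.riemannZetaNontrivialZeros.ne_one ρ.2)
    simp only [hZt]
    rw [norm_mul, show ((riemannZetaZeroOrder (ρ : ℂ) : ℤ) : ℂ) =
      (((riemannZetaZeroOrder (ρ : ℂ) : ℤ) : ℝ) : ℂ) by norm_cast, Complex.norm_real,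
      Real.norm_eq_abs, abs_of_nonneg hm0]
  have hfar_term : ∀ ρ : ↥((N : Set RHWave0.riemannZetaNontrivialZeros)ᶜ),
      ‖Zt ρ‖ ≤ D * ((riemannZetaZeroOrder ((ρ : RHWave0.riemannZetaNontrivialZeros) : ℂ) : ℝ) /
        ‖s - ((ρ : RHWave0.riemannZetaNontrivialZeros) : ℂ)‖ ^ 2) := by
    intro ρ
    have hmem := ρ.1.2
    have hζρ := ZetaZeros.riemannZetaNontrivialZeros.zeta_eq_zero hmem
    have hρ1 := ZetaZeros.riemannZetaNontrivialZeros.re_lt_one hmem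
    have hnot : ((ρ : RHWave0.riemannZetaNontrivialZeros) : ℂ) ∉ fordNearZeros t η := by
      intro hm
      have h2 : (ρ : RHWave0.riemannZetaNontrivialZeros) ∈ N := Finset.mem_subtype.2 hm
      exact (Set.mem_compl_iff _ _).1 ρ.2 (Finset.mem_coe.2 h2)
    rw [mem_fordNearZeros] at hnot
    push Not at hnot
    have hfar : η < ‖s - ((ρ : RHWave0.riemannZetaNontrivialZeros) : ℂ)‖ := by
      rw [hs]; exact hnot hζρ
    have hm0 : (0 : ℝ) ≤ riemannZetaZeroOrder ((ρ : RHWave0.riemannZetaNontrivialZeros) : ℂ) := by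
      exact_mod_cast riemannZetaZeroOrder_nonneg (ZetaZeros.riemannZetaNontrivialZeros.ne_one hmem)
    have hb := hD' (s - ρ) (by rw [sub_re, hsre]; linarith) hfar.le
    rw [hnormZ]
    calc (riemannZetaZeroOrder ((ρ : RHWave0.riemannZetaNontrivialZeros) : ℂ) : ℝ) *
          ‖fordLaplace₀ f (s - ((ρ : RHWave0.riemannZetaNontrivialZeros) : ℂ))‖
        ≤ (riemannZetaZeroOrder ((ρ : RHWave0.riemannZetaNontrivialZeros) : ℂ) : ℝ) *
          (D / ‖s - ((ρ : RHWave0.riemannZetaNontrivialZeros) : ℂ)‖ ^ 2) :=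
          mul_le_mul_of_nonneg_left hb hm0
      _ = _ := by ring
  have hfar_summ : Summable fun ρ : ↥((N : Set RHWave0.riemannZetaNontrivialZeros)ᶜ) ↦
      (riemannZetaZeroOrder ((ρ : RHWave0.riemannZetaNontrivialZeros) : ℂ) : ℝ) /
        ‖s - ((ρ : RHWave0.riemannZetaNontrivialZeros) : ℂ)‖ ^ 2 := by
    refine summable_of_sum_le (fun ρ ↦ div_nonneg ?_ (by positivity)) (sum_far_le s hs hS)
    exact Int.cast_nonneg (riemannZetaZeroOrder_nonneg
      (ZetaZeros.riemannZetaNontrivialZeros.ne_one ρ.1.2))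
  have hfar : ‖∑' ρ : ↥((N : Set RHWave0.riemannZetaNontrivialZeros)ᶜ), Zt ρ‖ ≤ D * S := by
    have h1 : Summable fun ρ : ↥((N : Set RHWave0.riemannZetaNontrivialZeros)ᶜ) ↦ ‖Zt ρ‖ :=
      hZn.comp_injective Subtype.val_injective
    calc ‖∑' ρ : ↥((N : Set RHWave0.riemannZetaNontrivialZeros)ᶜ), Zt ρ‖
        ≤ ∑' ρ : ↥((N : Set RHWave0.riemannZetaNontrivialZeros)ᶜ), ‖Zt ρ‖ := norm_tsum_le_tsum_norm h1
      _ ≤ ∑' ρ : ↥((N : Set RHWave0.riemannZetaNontrivialZeros)ᶜ),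
          D * ((riemannZetaZeroOrder ((ρ : RHWave0.riemannZetaNontrivialZeros) : ℂ) : ℝ) /
            ‖s - ((ρ : RHWave0.riemannZetaNontrivialZeros) : ℂ)‖ ^ 2) :=
          h1.tsum_le_tsum hfar_term (hfar_summ.mul_left D)
      _ = D * ∑' ρ : ↥((N : Set RHWave0.riemannZetaNontrivialZeros)ᶜ),
          (riemannZetaZeroOrder ((ρ : RHWave0.riemannZetaNontrivialZeros) : ℂ) : ℝ) /
            ‖s - ((ρ : RHWave0.riemannZetaNontrivialZeros) : ℂ)‖ ^ 2 := tsum_mul_left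
      _ ≤ D * S := mul_le_mul_of_nonneg_left
          (hfar_summ.tsum_le_of_sum_le (sum_far_le s hs hS)) hD0
  ------------------------------------------------------------------
  -- (c) the remainder and the pole term
  ------------------------------------------------------------------
  have hJ : ‖smoothedEFRemainder f s‖ ≤ D / 4 :=
    norm_smoothedEFRemainder_le h (by rw [hsre]) (by linarith) hD'
  have hpole : ‖fordLaplace₀ f (s - 1)‖ ≤ D := by
    have e : s - 1 = ((t : ℝ) : ℂ) * I := by rw [hs]; ring
    have hn : ‖s - 1‖ = t := by
      rw [e, norm_mul, Complex.norm_I, mul_one, Complex.norm_real, Real.norm_eq_abs,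
        abs_of_pos (by linarith)]
    have hb := hD' (s - 1) (by rw [e]; simp) (by rw [hn]; linarith)
    rw [hn] at hb
    refine hb.trans ?_
    rw [div_le_iff₀ (by positivity)]
    have : D * 1 ≤ D * t ^ 2 := mul_le_mul_of_nonneg_left (by nlinarith) hD0
    linarith
  ------------------------------------------------------------------
  -- (d) assembling the real parts
  ------------------------------------------------------------------
  -- real part of the explicit formula
  have hre := congrArg Complex.re hE
  rw [← hsplit, hnear] at hre
  simp only [add_re, sub_re, neg_mul, neg_re, Complex.re_ofReal_mul] at hre
  -- the near sums, compared with `fordNearSum`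
  have hnearsum : -fordNearSum f η t =
      -(∑ ρ ∈ fordNearZeros t η, (riemannZetaZeroOrder ρ : ℂ) * fordLaplace₀ f (s - ρ)).re +
        f 0 * ∑ ρ ∈ S₀, (riemannZetaZeroOrder ρ : ℝ) * (fordCot η (ρ - s)).re := by
    have hsum0 : ∑ ρ ∈ fordNearZeros t η, (riemannZetaZeroOrder ρ : ℝ) * (fordCot η (ρ - s)).re =
        ∑ ρ ∈ S₀, (riemannZetaZeroOrder ρ : ℝ) * (fordCot η (ρ - s)).re := by
      rw [hS₀, Finset.sum_filter]
      refine Finset.sum_congr rfl fun ρ hρ ↦ ?_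
      split_ifs with hc
      · rfl
      · rw [hcot0 ρ hρ (by rw [hS₀, Finset.mem_filter]; exact fun h' ↦ hc h'.2), mul_zero]
    rw [← hsum0, fordNearSum, Complex.re_sum, ← hs]
    rw [Finset.mul_sum, ← Finset.sum_neg_distrib, ← Finset.sum_neg_distrib, ← Finset.sum_add_distrib]
    refine Finset.sum_congr rfl fun ρ hρ ↦ ?_
    have hc := hcot ρ hρ
    have hm : ((riemannZetaZeroOrder ρ : ℂ) * fordLaplace₀ f (s - ρ)).re =
        (riemannZetaZeroOrder ρ : ℝ) * (fordLaplace₀ f (s - ρ)).re := by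
      rw [show ((riemannZetaZeroOrder ρ : ℤ) : ℂ) = (((riemannZetaZeroOrder ρ : ℤ) : ℝ) : ℂ) by
        norm_cast, Complex.re_ofReal_mul]
    rw [hm, re_fordLaplace₀ f (s - ρ), add_re, Complex.re_ofReal_mul, sub_re, hc]
    ring
  -- the detector multiplied by `f(0)`
  have hdet : -(f 0 * (deriv riemannZeta s / riemannZeta s).re) ≤
      f 0 * (∑ ρ ∈ S₀, (riemannZetaZeroOrder ρ : ℝ) * (fordCot η (ρ - s)).re) +
        f 0 / (4 * η) * (fordLogZetaIntegral (1 - η) t (2 * η / π) -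
          fordLogZetaIntegral (1 + η) t (2 * η / π)) := by
    have h1 := mul_le_mul_of_nonneg_left hZD hf0
    have e : f 0 / (4 * η) = f 0 * (1 / (4 * η)) := by ring
    rw [e, mul_assoc, ← mul_add]
    unfold fordLogZetaIntegral
    linarith [h1]
  -- bounds for the scalar real parts
  have h1 : (fordLaplace₀ f (s - 1)).re ≤ D := (Complex.re_le_norm _).trans hpole
  have h2 : -(∑' ρ : ↥((N : Set RHWave0.riemannZetaNontrivialZeros)ᶜ), Zt ρ).re ≤ D * S := by
    have := Complex.abs_re_le_norm (∑' ρ : ↥((N : Set RHWave0.riemannZetaNontrivialZeros)ᶜ), Zt ρ)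
    have := neg_abs_le (∑' ρ : ↥((N : Set RHWave0.riemannZetaNontrivialZeros)ᶜ), Zt ρ).re
    linarith
  have h3 : (smoothedEFRemainder f s).re ≤ D / 4 := (Complex.re_le_norm _).trans hJ
  -- conclusion
  unfold FordDetectorIneqRaw
  rw [← hs, hnearsum]
  have hSD : D * (5 / 4 + S) ≤ D * (1.8 + Real.log t / 3 + S) := by
    refine mul_le_mul_of_nonneg_left ?_ hD0
    norm_num
    linarith
  simp only [hZt] at hre h2
  linarith [hre, hdet, h1, h2, h3, hSD]

/-! ### Ford's Lemma 4.6, second part: `K(1) ≤ F(0) + 1.8D` -/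

/-- **`K(σ) ≤ F(σ−1) + 0.2963 D` for `1 < σ < 3/2`** (Ford's (4.9): the explicit formula at the
real point `σ`, `−ζ'/ζ(σ) < 1/(σ−1)`, `F₀(σ−1) = F(σ−1) − f(0)/(σ−1)`,
`Σ|F₀(σ−ρ)| ≤ D Σ m(ρ)/|1−ρ|² ≤ 0.0463D`, and `|J(σ)| ≤ D/4` in place of `1.72D`).
[cite: Ford2002Millennium, Lemma 4.6 (proof, (4.9))] -/
theorem re_fordK_ofReal_le (h : IsSmoothedEFTest f p p' p'' x₀) {η D : ℝ} (hη2 : η ≤ 1)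
    (hf0 : 0 ≤ f 0)
    (hD : ∀ z : ℂ, 0 ≤ z.re → η ≤ ‖z‖ → ‖fordLaplace f z - (f 0 : ℂ) / z‖ ≤ D / ‖z‖ ^ 2)
    {σ : ℝ} (hσ1 : 1 < σ) (hσ2 : σ < 3 / 2) :
    (fordK f σ).re ≤ (fordLaplace f ((σ : ℂ) - 1)).re + 0.2963 * D := by
  classical
  have hD0 : 0 ≤ D := D_nonneg (by linarith) hD
  have hD' : ∀ z : ℂ, 0 ≤ z.re → η ≤ ‖z‖ → ‖fordLaplace₀ f z‖ ≤ D / ‖z‖ ^ 2 := hD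
  set s : ℂ := (σ : ℂ) with hs
  have hsre : s.re = σ := by simp [hs]
  have hs1 : s ≠ 1 := fun h0 ↦ by
    have := congrArg Complex.re h0; rw [hsre] at this; simp at this; linarith
  have hζs : riemannZeta s ≠ 0 := riemannZeta_ne_zero_of_one_le_re (by rw [hsre]; exact hσ1.le)
  have hE := fordK_eq_explicit h (s := s) (by rw [hsre]; linarith) (by rw [hsre]; linarith) hs1 hζs
  -- the zero sum, bounded by `0.0463 D`
  set Zt : RHWave0.riemannZetaNontrivialZeros → ℂ := fun ρ ↦
    (riemannZetaZeroOrder (ρ : ℂ) : ℂ) * fordLaplace₀ f (s - ρ) with hZt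
  have hZn : Summable fun ρ ↦ ‖Zt ρ‖ := summable_norm_zeroTerm h (by rw [hsre]; linarith) hζs
  have hterm : ∀ ρ : RHWave0.riemannZetaNontrivialZeros,
      ‖Zt ρ‖ ≤ D * ((riemannZetaZeroOrder (ρ : ℂ) : ℝ) / ‖1 - (ρ : ℂ)‖ ^ 2) := by
    intro ρ
    have hmem := ρ.2
    have hρ1 := ZetaZeros.riemannZetaNontrivialZeros.re_lt_one hmem
    have hne1 := ZetaZeros.riemannZetaNontrivialZeros.ne_one hmem
    have hm0 : (0 : ℝ) ≤ riemannZetaZeroOrder (ρ : ℂ) := by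
      exact_mod_cast riemannZetaZeroOrder_nonneg hne1
    have him := FordL33.fourteen_lt_abs_im ρ
    have hnorm_im : |(ρ : ℂ).im| ≤ ‖s - (ρ : ℂ)‖ := by
      have := Complex.abs_im_le_norm (s - (ρ : ℂ))
      rw [sub_im] at this
      simpa [hs] using this
    have hb := hD' (s - ρ) (by rw [sub_re, hsre]; linarith) (by linarith)
    have hcmp : ‖1 - (ρ : ℂ)‖ ^ 2 ≤ ‖s - (ρ : ℂ)‖ ^ 2 := by
      rw [Complex.sq_norm, Complex.sq_norm, Complex.normSq_apply, Complex.normSq_apply]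
      simp only [sub_re, one_re, sub_im, one_im, hsre, zero_sub]
      have hsim : s.im = 0 := by simp [hs]
      rw [hsim, zero_sub]
      nlinarith
    have hpos : 0 < ‖1 - (ρ : ℂ)‖ ^ 2 := by
      have : 0 < ‖1 - (ρ : ℂ)‖ := norm_pos_iff.2 (sub_ne_zero.2 (Ne.symm hne1))
      positivity
    have hnZ : ‖Zt ρ‖ = (riemannZetaZeroOrder (ρ : ℂ) : ℝ) * ‖fordLaplace₀ f (s - ρ)‖ := by
      simp only [hZt]
      rw [norm_mul, show ((riemannZetaZeroOrder (ρ : ℂ) : ℤ) : ℂ) =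
        (((riemannZetaZeroOrder (ρ : ℂ) : ℤ) : ℝ) : ℂ) by norm_cast, Complex.norm_real,
        Real.norm_eq_abs, abs_of_nonneg hm0]
    rw [hnZ]
    calc (riemannZetaZeroOrder (ρ : ℂ) : ℝ) * ‖fordLaplace₀ f (s - ρ)‖
        ≤ (riemannZetaZeroOrder (ρ : ℂ) : ℝ) * (D / ‖s - (ρ : ℂ)‖ ^ 2) :=
          mul_le_mul_of_nonneg_left hb hm0
      _ ≤ (riemannZetaZeroOrder (ρ : ℂ) : ℝ) * (D / ‖1 - (ρ : ℂ)‖ ^ 2) :=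
          mul_le_mul_of_nonneg_left (div_le_div_of_nonneg_left hD0 hpos hcmp) hm0
      _ = _ := by ring
  have hsumm1 : Summable fun ρ : RHWave0.riemannZetaNontrivialZeros ↦
      (riemannZetaZeroOrder (ρ : ℂ) : ℝ) / ‖1 - (ρ : ℂ)‖ ^ 2 := by
    -- comparison with `m(ρ)/|ρ|²` through the reflection `ρ ↦ 1 − conj ρ` is in the tree; here
    -- we compare with the summable `m(ρ)/(1+γ²)`: `|1−ρ|² ≥ γ² ≥ (196/197)(1+γ²)`
    refine (ZetaZeroSum.summable_zeroOrder_div_one_add_sq.mul_left (197 / 196)).of_nonneg_of_le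
      (fun ρ ↦ div_nonneg ?_ (by positivity)) fun ρ ↦ ?_
    · exact_mod_cast riemannZetaZeroOrder_nonneg (ZetaZeros.riemannZetaNontrivialZeros.ne_one ρ.2)
    · have him := FordL33.fourteen_lt_abs_im ρ
      have hm0 : (0 : ℝ) ≤ riemannZetaZeroOrder (ρ : ℂ) := by
        exact_mod_cast riemannZetaZeroOrder_nonneg (ZetaZeros.riemannZetaNontrivialZeros.ne_one ρ.2)
      have h1 : (ρ : ℂ).im ^ 2 ≤ ‖1 - (ρ : ℂ)‖ ^ 2 := by
        have := Complex.abs_im_le_norm (1 - (ρ : ℂ))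
        rw [sub_im, one_im, zero_sub, abs_neg] at this
        nlinarith [abs_nonneg ((ρ : ℂ).im), norm_nonneg (1 - (ρ : ℂ)), sq_abs ((ρ : ℂ).im)]
      have h196 : (196 : ℝ) ≤ (ρ : ℂ).im ^ 2 := by
        have := sq_abs ((ρ : ℂ).im); nlinarith [abs_nonneg ((ρ : ℂ).im)]
      have hpos : 0 < ‖1 - (ρ : ℂ)‖ ^ 2 := by nlinarith
      have key : (riemannZetaZeroOrder (ρ : ℂ) : ℝ) / ‖1 - (ρ : ℂ)‖ ^ 2 ≤
          197 / 196 * ((riemannZetaZeroOrder (ρ : ℂ) : ℝ) / (1 + (ρ : ℂ).im ^ 2)) := by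
        rw [div_le_iff₀ hpos]
        have e : 197 / 196 * ((riemannZetaZeroOrder (ρ : ℂ) : ℝ) / (1 + (ρ : ℂ).im ^ 2)) *
            ‖1 - (ρ : ℂ)‖ ^ 2 = (riemannZetaZeroOrder (ρ : ℂ) : ℝ) *
              ((197 / 196) * ‖1 - (ρ : ℂ)‖ ^ 2 / (1 + (ρ : ℂ).im ^ 2)) := by
          field_simp
        rw [e]
        refine le_mul_of_one_le_right hm0 ?_
        rw [le_div_iff₀ (by positivity)]
        nlinarith
      calc _ ≤ 197 / 196 * ((riemannZetaZeroOrder (ρ : ℂ) : ℝ) / (1 + (ρ : ℂ).im ^ 2)) := key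
        _ = _ := by ring
  have hZsum : ‖∑' ρ, Zt ρ‖ ≤ 0.0463 * D := by
    calc ‖∑' ρ, Zt ρ‖ ≤ ∑' ρ, ‖Zt ρ‖ := norm_tsum_le_tsum_norm hZn
      _ ≤ ∑' ρ : RHWave0.riemannZetaNontrivialZeros,
          D * ((riemannZetaZeroOrder (ρ : ℂ) : ℝ) / ‖1 - (ρ : ℂ)‖ ^ 2) :=
          hZn.tsum_le_tsum hterm (hsumm1.mul_left D)
      _ = D * ∑' ρ : RHWave0.riemannZetaNontrivialZeros,
          (riemannZetaZeroOrder (ρ : ℂ) : ℝ) / ‖1 - (ρ : ℂ)‖ ^ 2 := tsum_mul_left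
      _ ≤ D * 0.0463 := mul_le_mul_of_nonneg_left tsum_zeroOrder_div_norm_one_sub_sq_le hD0
      _ = 0.0463 * D := by ring
  -- the remainder
  have hJ : ‖smoothedEFRemainder f s‖ ≤ D / 4 :=
    norm_smoothedEFRemainder_le h (by rw [hsre]; exact hσ1.le) (by linarith) hD'
  -- the logarithmic derivative and the polar part
  have hL31 := neg_logDeriv_riemannZeta_ofReal_lt hσ1
  have hpolar : (fordLaplace₀ f (s - 1)).re = (fordLaplace f (s - 1)).re - f 0 / (σ - 1) := by
    rw [re_fordLaplace₀ f (s - 1)]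
    congr 1
    have e : s - 1 = ((σ - 1 : ℝ) : ℂ) := by rw [hs]; push_cast; ring
    rw [e, show (1 : ℂ) / ((σ - 1 : ℝ) : ℂ) = (((1 / (σ - 1)) : ℝ) : ℂ) by push_cast; ring,
      Complex.ofReal_re]
    ring
  -- real parts
  have hre := congrArg Complex.re hE
  simp only [add_re, sub_re, neg_mul, neg_re, Complex.re_ofReal_mul] at hre
  have h1 : -(f 0 * (deriv riemannZeta s / riemannZeta s).re) ≤ f 0 * (1 / (σ - 1)) := by
    have e : (-deriv riemannZeta (σ : ℂ) / riemannZeta σ).re = -(deriv riemannZeta s / riemannZeta s).re := by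
      rw [neg_div, neg_re]
    rw [e] at hL31
    nlinarith [hL31.le]
  have h2 : -(∑' ρ, Zt ρ).re ≤ 0.0463 * D := by
    have := Complex.abs_re_le_norm (∑' ρ, Zt ρ)
    have := neg_abs_le (∑' ρ, Zt ρ).re
    linarith
  have h3 : (smoothedEFRemainder f s).re ≤ D / 4 := (Complex.re_le_norm _).trans hJ
  have e1 : f 0 * (1 / (σ - 1)) = f 0 / (σ - 1) := by ring
  simp only [hZt] at hre h2
  linarith [hre, h1, h2, h3, hpolar, e1]

/-- **Ford's Lemma 4.6, second display, for an admissible smoothing: `K(1) ≤ F(0) + 0.3 D`**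
(`σ ↓ 1` in `re_fordK_ofReal_le`: `K` is continuous, `F` is entire).
[cite: Ford2002Millennium, Lemma 4.6] [cite: MossinghoffTrudgianYangRNT2024, Lemma 4.2] -/
theorem re_fordK_one_le (h : IsSmoothedEFTest f p p' p'' x₀) {η D : ℝ} (hη2 : η ≤ 1)
    (hf0 : 0 ≤ f 0)
    (hD : ∀ z : ℂ, 0 ≤ z.re → η ≤ ‖z‖ → ‖fordLaplace f z - (f 0 : ℂ) / z‖ ≤ D / ‖z‖ ^ 2) :
    (fordK f 1).re ≤ (fordLaplace f 0).re + 0.3 * D := by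
  have hD0 : 0 ≤ D := D_nonneg (by linarith) hD
  set g : ℝ → ℝ := fun σ ↦ (fordK f σ).re with hg
  set k : ℝ → ℝ := fun σ ↦ (fordLaplace f ((σ : ℂ) - 1)).re + 0.2963 * D with hk
  have hgc : Continuous g :=
    Complex.continuous_re.comp ((continuous_fordK h.eq_zero).comp Complex.continuous_ofReal)
  have hkc : Continuous k := by
    refine Continuous.add ?_ continuous_const
    exact Complex.continuous_re.comp
      ((differentiable_fordLaplace h.cont h.x₀_nonneg h.eq_zero).continuous.comp
        (Complex.continuous_ofReal.sub continuous_const))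
  have hev : ∀ᶠ σ in 𝓝[>] (1 : ℝ), g σ ≤ k σ := by
    filter_upwards [Ioo_mem_nhdsGT (by norm_num : (1 : ℝ) < 3 / 2)] with σ hσ
    exact re_fordK_ofReal_le h hη2 hf0 hD hσ.1 hσ.2
  have hg1 : Tendsto g (𝓝[>] (1 : ℝ)) (𝓝 (g 1)) := (hgc.tendsto 1).mono_left nhdsWithin_le_nhds
  have hk1 : Tendsto k (𝓝[>] (1 : ℝ)) (𝓝 (k 1)) := (hkc.tendsto 1).mono_left nhdsWithin_le_nhds
  have hle := le_of_tendsto_of_tendsto hg1 hk1 hev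
  simp only [hg, hk, Complex.ofReal_one, sub_self] at hle
  linarith

/-- **`K(1) ≤ F(0) + 1.8 D`** — Ford's Lemma 4.6, second display, as printed (from
`re_fordK_one_le`, `D ≥ 0`). [cite: Ford2002Millennium, Lemma 4.6]
[cite: MossinghoffTrudgianYangRNT2024, Lemma 4.2] -/
theorem re_fordK_one_le' (h : IsSmoothedEFTest f p p' p'' x₀) {η D : ℝ} (hη2 : η ≤ 1)
    (hf0 : 0 ≤ f 0)
    (hD : ∀ z : ℂ, 0 ≤ z.re → η ≤ ‖z‖ → ‖fordLaplace f z - (f 0 : ℂ) / z‖ ≤ D / ‖z‖ ^ 2) :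
    (fordK f 1).re ≤ (fordLaplace f 0).re + 1.8 * D := by
  have hD0 : 0 ≤ D := D_nonneg (by linarith) hD
  have := re_fordK_one_le h hη2 hf0 hD
  linarith

end FordL46

end Literature.NumberTheory.LFunctions
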